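import Literature.AlgebraicGeometry.Motives.PoincareUniversal.ExistsThickeningLift
import Literature.AlgebraicGeometry.AbelianVarieties.PoincareSheafNormalised
import Literature.AlgebraicGeometry.Motives.AbelianVarietyProjectiveChart
import Literature.AlgebraicGeometry.Morphisms.CechH1AffineCoverIndependence
import Literature.AlgebraicGeometry.HodgeTheory.AbelianVarietyCechH1StructureSheafBound
import HarnessLib

/-!
# `dim_ℂ Ȟ¹(𝔘, 𝒪_A) = dim A` for a complex abelian variety (Mumford, *Abelian Varieties*, §13 Cor. 2)

D. Mumford, *Abelian Varieties* (1970), §13, Corollary 2 (p. 129): «`dim H¹(X, 𝒪_X) = g`» for an abelian variety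
`X` of dimension `g`.  Here in the tree's Zariski–Čech currency: for a complex abelian variety `A₀` and EVERY finite
affine open cover `𝔘` of `A₀`, `finrank ℂ Ȟ¹(𝔘, 𝒪_{A₀}) = dim A₀` (`AbelianVariety.finrank_cechH1_structureSheaf_eq_dim`).

The inequality `≤` is ★ `HodgeTheory/AbelianVarietyCechH1StructureSheafBound` (GAGA-injectivity + Dolbeault +
`h^{0,1} = g`).  The inequality `≥` is Mumford's deformation-theoretic argument (§13, proof of the Theorem,
pp. 125–130; [GortzWedhorn2023] Prop. 27.122): for the normalised Poincaré sheaf `𝒫` on `A₀ × Â`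
(★ `AbelianVarieties/PoincareSheafNormalised.exists_poincareSheaf_normalised`, `Â = A₀/K(Θ)` for an ample `Θ`,
★ `Motives.ChartFamily.exists_isAmple_of_chart`) the Kodaira–Spencer map of the first-order Artinian chart of `𝒫`
at a closed point `y₀ ∈ Â`,
`KS : Der_ℂ(𝒪_{Â,y₀}/𝔪², ℂ) → Ȟ¹(𝔘, 𝒪_{A₀})`, is INJECTIVE (★ `PoincareUniversal/KodairaSpencerInjective.ksLinear_injective_of_rigid`
from the first-order rigidity of `𝒫`, ★ `PoincareUniversal/PoincareFirstOrderRigid.poincare_firstOrderRigid`), and its source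
has dimension `dim Â = dim A₀` (★ `PoincareUniversal/LevelTangentDimension.finrank_derAt_ρℂ`, ★ `AbelianVariety.dim_dualOf`);
frames of `𝒫` on the Artinian charts come from a finite affine cover trivialising `𝒫|_{A₀ × y₀}`
(★ `Modules/FiniteAffineTrivialisingCover`, ★ `PoincareUniversal/LevelZeroGraphPoint.framesP0`,
★ `PoincareUniversal/ArtinianLevelFrames.framesP`).  Cover independence of `Ȟ¹` of the structure sheaf
(★ `Morphisms/CechH1AffineCoverIndependence.finrank_cechH1_eq_of_isAffineOpen`, Hartshorne III Thm. 4.5) moves the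
equality to every finite affine open cover.

* `AbelianVariety.dim_le_finrank_cechH1_structureSheaf_of_poincare` — `dim A₀ ≤ finrank Ȟ¹(𝔘, 𝒪)` on a finite affine
  cover carrying frames of `𝒫|_{A₀ × y₀}` (the Kodaira–Spencer step, `𝒫` and `Θ` as hypotheses);
* `AbelianVariety.exists_cover_finrank_cechH1_structureSheaf_eq_dim` — SOME finite affine open cover with equality;
* **`AbelianVariety.finrank_cechH1_structureSheaf_eq_dim`** — equality on EVERY finite affine open cover.

Everything here is proved; no definitions, no named facts.  Cell hodgecm-mathlib, (F)-census §4 (α) node E2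
(«`h¹(A, 𝒪) = g`, the ★ bound is `≤ g`, equality M»); B-p07 (g13).  HC_CM is proved only modulo the 7 printed
citations until rung 0 closes.

## References
* [MumfordAV1970] D. Mumford, *Abelian Varieties* (1970), §13 Cor. 2 (p. 129) and the proof of the Theorem (pp. 125–130).
* [GortzWedhorn2023] U. Görtz, T. Wedhorn, *Algebraic Geometry II* (2023), Prop. 27.122.
* [Hartshorne1977] R. Hartshorne, *Algebraic Geometry* (1977), III Thm. 4.5 (p. 222).
-/

noncomputable section

open CategoryTheory CategoryTheory.Limits AlgebraicGeometry MonoidalCategory CartesianMonoidalCategory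
open scoped DualNumber

namespace Literature.AlgebraicGeometry.HodgeTheory

open Literature.AlgebraicGeometry.AbelianSchemes Literature.AlgebraicGeometry.AbelianVarieties
  Literature.AlgebraicGeometry.Modules Literature.AlgebraicGeometry.Morphisms
  Literature.AlgebraicGeometry.Morphisms.CechUnitCocycle Literature.AlgebraicGeometry.Motives
  Literature.AlgebraicGeometry.Motives.AbelianVariety

section EqDim

variable (A₀ : AbelianVariety ℂ)

/-- **The Kodaira–Spencer step: `dim A₀ ≤ dim_ℂ Ȟ¹(𝔘, 𝒪_{A₀})`** on a finite affine open cover `𝔘 = (V a)` of `A₀`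
carrying frames of `𝒫|_{A₀ × b}` for a `ℂ`-point `b` of `Â = A₀/K(Θ)`, where `𝒫` is a rank-one quasi-coherent module on
`A₀ × Â` with `(1 × φ_Θ)^*𝒫 ≅ Λ(𝒪(Θ))` (the normalised Poincaré sheaf): the Kodaira–Spencer map of the first-order
Artinian chart of `𝒫` at `b` is an injective `ℂ`-linear map `Der(𝒪_{Â,b}/𝔪², ℂ) → Ȟ¹(𝔘, 𝒪_{A₀})` out of a space of
dimension `dim Â = dim A₀`. [cite: MumfordAV1970, §13 (proof of the Thm. pp. 125–130) and Cor. 2 (p. 129)]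
[cite: GortzWedhorn2023, Prop. 27.122] -/
theorem AbelianVariety.dim_le_finrank_cechH1_structureSheaf_of_poincare
    {Θ : CartierDivisor A₀.X.left} (hΘ : Θ.IsAmple)
    (P : (A₀.X ⊗ (A₀.dualOf Θ hΘ).X).left.Modules) [P.IsQuasicoherent] (hP1 : HasRank P 1)
    (eP : Nonempty ((Scheme.Modules.pullback (AbelianVariety.Hom.toSchemeHom (A₀.oneProdPhiTheta hΘ))).obj P ≅
      mumfordSheaf A₀ Θ))
    (b : AlgPoints (A₀.dualOf Θ hΘ).X ℂ)
    {ι : Type} [Finite ι] (V : ι → A₀.X.left.Opens) (hV : ∀ a, IsAffineOpen (V a)) (hcov : iSup V = ⊤)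
    (FM : IFrames ((Scheme.Modules.pullback (sliceMor A₀ b).left).obj P) V) :
    Module.Finite ℂ (CechH1 A₀.X.hom V) ∧ A₀.dim ≤ Module.finrank ℂ (CechH1 A₀.X.hom V) := by
  classical
  haveI : LocallyOfFiniteType (A₀.dualOf Θ hΘ).X.hom := (A₀.dualOf Θ hΘ).isProper.toLocallyOfFiniteType
  haveI : IsLocallyNoetherian (A₀.dualOf Θ hΘ).X.left :=
    LocallyOfFiniteType.isLocallyNoetherian (A₀.dualOf Θ hΘ).X.hom
  haveI : IsSeparated A₀.X.hom := A₀.isProper.toIsSeparated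
  -- the closed point `y₀ = pt b` of `Â` and its level-zero data
  have hy₀ : IsClosed ({AlgPoints.pt b} : Set (A₀.dualOf Θ hΘ).X.left) := AlgPoints.isClosed_singleton_pt b
  have hb : b.left (IsLocalRing.closedPoint ℂ) = AlgPoints.pt b := rfl
  have huniq := algHom_levelZero_eq (A₀.dualOf Θ hΘ).X (AlgPoints.pt b) hy₀
  have hbij := ρℂ_zero_bijective (A₀.dualOf Θ hΘ).X (AlgPoints.pt b) hy₀
  -- frames of `𝒫` on every Artinian level of `Â` at `y₀` (γ4 from the level-0 frames γ6)
  let FP := framesP A₀ hΘ P (AlgPoints.pt b) V hV hP1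
    (framesP0 A₀ hΘ P (AlgPoints.pt b) hy₀ V b hb huniq hbij FM)
  -- (γ8) injectivity of the Kodaira–Spencer map of the first-order chart, from the first-order rigidity of `𝒫`
  have hinj := ksLinear_injective_of_rigid A₀ hΘ P V hV (AlgPoints.pt b) hy₀ hcov hP1
    (poincare_firstOrderRigid A₀ hΘ P eP) 0 (FP (0 + 1))
  -- (γ9) its source has dimension `dim Â = dim A₀`
  obtain ⟨hfinD, hdimD⟩ := finrank_derAt_ρℂ (A₀.dualOf Θ hΘ) (AlgPoints.pt b) hy₀ 0
  rw [AbelianVariety.dim_dualOf] at hdimD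
  -- (3e) `Ȟ¹(𝔘, 𝒪)` is finite-dimensional
  obtain ⟨hfinH, -⟩ :=
    HodgeTheory.AbelianVariety.socket_N3e_cechH1_finrank_le_holds A₀ ι inferInstance V hV hcov
  haveI := hfinD
  haveI := hfinH
  refine ⟨hfinH, ?_⟩
  rw [← hdimD]
  exact LinearMap.finrank_le_finrank_of_injective hinj

/-- **`dim_ℂ Ȟ¹(𝔘, 𝒪_{A₀}) = dim A₀` on SOME finite affine open cover** of a complex abelian variety `A₀`: take an ample
`Θ` (★ `ChartFamily.exists_isAmple_of_chart`), the normalised Poincaré sheaf `𝒫` on `A₀ × A₀/K(Θ)`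
(★ `exists_poincareSheaf_normalised`), the `ℂ`-point `b = 0` of `Â`, a finite affine cover trivialising the line bundle
`𝒫|_{A₀ × b}`, and combine `dim A₀ ≤ finrank` (`dim_le_finrank_cechH1_structureSheaf_of_poincare`) with the ★ bound
`finrank ≤ dim A₀`. [cite: MumfordAV1970, §13 Cor. 2 (p. 129)] -/
theorem AbelianVariety.exists_cover_finrank_cechH1_structureSheaf_eq_dim :
    ∃ (ι : Type) (_ : Finite ι) (V : ι → A₀.X.left.Opens), (∀ a, IsAffineOpen (V a)) ∧ iSup V = ⊤ ∧
      Module.Finite ℂ (CechH1 A₀.X.hom V) ∧ Module.finrank ℂ (CechH1 A₀.X.hom V) = A₀.dim := by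
  classical
  -- an ample divisor and the normalised Poincaré sheaf
  obtain ⟨Θ, hΘ⟩ := ChartFamily.exists_isAmple_of_chart A₀
  -- `(A₀.prod Â).X` is `A₀.X ⊗ Â.X` by `rfl`: read the existence statement in the monoidal spelling, so that the
  -- quasi-coherence instance is keyed on the type the Poincaré files use
  obtain ⟨P, hqc, hP1, ⟨eP⟩, -⟩ :
      ∃ (P : (A₀.X ⊗ (A₀.dualOf Θ hΘ).X).left.Modules) (_ : P.IsQuasicoherent) (_ : HasRank P 1),
        Nonempty ((Scheme.Modules.pullback (AbelianVariety.Hom.toSchemeHom (A₀.oneProdPhiTheta hΘ))).obj P ≅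
            mumfordSheaf A₀ Θ) ∧
          Nonempty ((Scheme.Modules.pullback (sliceZero A₀ (A₀.dualOf Θ hΘ)).left).obj P ≅
            unitModule (A₀.dualOf Θ hΘ).X.left) :=
    exists_poincareSheaf_normalised A₀ hΘ
  haveI : P.IsQuasicoherent := hqc
  -- the origin of `Â` and a finite affine cover of `A₀` trivialising `𝒫|_{A₀ × 0}`
  let b : AlgPoints (A₀.dualOf Θ hΘ).X ℂ := (1 : (A₀.dualOf Θ hΘ).Points ℂ)
  obtain ⟨ι, hfin, V, hV, hcov, hfr⟩ := exists_finite_affine_trivialising_cover A₀.X.left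
    ((Scheme.Modules.pullback (sliceMor A₀ b).left).obj P) (hasRank_pullback _ hP1)
  haveI := hfin
  let FM : IFrames ((Scheme.Modules.pullback (sliceMor A₀ b).left).obj P) V := ⟨fun a => (hfr a).some⟩
  obtain ⟨hfinH, hge⟩ :=
    AbelianVariety.dim_le_finrank_cechH1_structureSheaf_of_poincare A₀ hΘ P hP1 ⟨eP⟩ b V hV hcov FM
  obtain ⟨-, hle⟩ :=
    HodgeTheory.AbelianVariety.socket_N3e_cechH1_finrank_le_holds A₀ ι hfin V hV hcov
  exact ⟨ι, hfin, V, hV, hcov, hfinH, le_antisymm hle hge⟩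

/-- **Mumford §13 Cor. 2 in Zariski–Čech form: `dim_ℂ Ȟ¹(𝔘, 𝒪_{A₀}) = dim A₀` on EVERY finite affine open cover `𝔘`
of a complex abelian variety `A₀`** (cover independence of `Ȟ¹` of the structure sheaf, Hartshorne III Thm. 4.5, from the
one cover of `exists_cover_finrank_cechH1_structureSheaf_eq_dim`). [cite: MumfordAV1970, §13 Cor. 2 (p. 129)]
[cite: Hartshorne1977, III Thm. 4.5 (p. 222)] -/
theorem AbelianVariety.finrank_cechH1_structureSheaf_eq_dim {κ : Type} [Finite κ]
    (U : κ → A₀.X.left.Opens) (hU : ∀ i, IsAffineOpen (U i)) (hUcov : iSup U = ⊤) :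
    Module.Finite ℂ (CechH1 A₀.X.hom U) ∧ Module.finrank ℂ (CechH1 A₀.X.hom U) = A₀.dim := by
  obtain ⟨ι, hfin, V, hV, hcov, hfinV, heq⟩ := AbelianVariety.exists_cover_finrank_cechH1_structureSheaf_eq_dim A₀
  haveI := hfin
  refine ⟨(HodgeTheory.AbelianVariety.socket_N3e_cechH1_finrank_le_holds A₀ κ inferInstance U hU hUcov).1, ?_⟩
  rw [Morphisms.finrank_cechH1_eq_of_isAffineOpen A₀.X.hom U V hU hV hUcov hcov]
  exact heq

end EqDim

end Literature.AlgebraicGeometry.HodgeTheory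

end
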